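import Summits.ResolutionOfSingularities.ResolutionOfSingularities.Theorems.HilbertSamuelEliminationSigmaMaxModificationsCorridor3WLadderRecognitionNearLocusWFibres
import Summits.ResolutionOfSingularities.ResolutionOfSingularities.Theorems.HilbertSamuelEliminationSigmaMaxModificationsCorridor3WLadderRecognitionNearLocusCurve
import HarnessLib

/-!
# [OURS · L1 W4.2] RECOGNITION-GEOMETRY (R2), WAITING-TOLERANT FORM WITH A PARAMETRIC POINT HYPOTHESIS `F`, PART 2: the dominant case — `N_{j+1}(x)` is an
# irreducible curve mapped ISOMORPHICALLY onto `C_j` (crux chain w42, line `w_ladder`; `--supports stmt-…-19249`, helper)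

OURS (cell res-hironaka, slot W4.2, seat res-L1-w42-stub-2 gen 4); NOT statements of H. Hironaka's manuscript [Hironaka2017]
nor of [CossartJannsenSaito2020]. AI-drafted, weaker than expert review. Sorry-free PROOF file (no new definition).

`…WLadderRecognitionNearLocusCurve` RE-ISSUED with the point hypothesis `F` as a parameter (see PART 1
`…RecognitionNearLocusWFibres`): section variables `F`, `h314f` (near-fibre rendering keyed on `F`), `hPb` (residual rationality at a
near point over a point centre with `e = 1`, keyed on `F`), `h314` (the numerical Thm. 3.14 keyed on `F`); standing hypothesis
`hF : ∀ i, ∀ y ∈ N_i(x), F (X_i) y`. Same theorem names as the (F1) file, in the namespace `BlowupTowerNearW`: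
`isClosed_singleton_of_mem_nearLocus_succ`, `bijOn_nearLocus_succ_of_dominant`, `isIrreducible_…`, `nontrivial_…`,
`isGenericPoint_iff_of_dominant`, `isClosed_singleton_of_mem_nearLocus_succ_of_dominant`, `isIso_residueFieldMap_of_mem_nearLocus_succ`
(`κ(η_j) = κ(η_{j+1})`), **`inducesIsoOn_nearLocus_succ_of_dominant`** (CJS Def. 6.38 (iv)), **(G2) `isRegular_nearLocus_succ_of_dominant`**.

## References

* V. Cossart, U. Jannsen, S. Saito, LNM 2270 (2020): Thm. 3.6, Thm. 3.10, Thm. 3.14, (6.24), Def. 6.38 (iii)–(iv), proof of Thm. 6.28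
  Step 2 (p. 94), p. 104. [CossartJannsenSaito2020]
-/

noncomputable section

-- namespace `…Corridor3.Helpers` re-enters `…Corridor3`
set_option linter.dupNamespace false

open CategoryTheory AlgebraicGeometry TopologicalSpace IsLocalRing
open Literature.AlgebraicGeometry.Resolution
open Scheme.IdealSheafData

universe u

open Literature.AlgebraicGeometry.CossartJannsenSaito2020

namespace Summit.ResolutionOfSingularities.ResolutionOfSingularities.Theorems.SigmaMaxModificationsCorridor3.Helpers

namespace BlowupTowerNearW

/-! The point hypothesis `F` (the rôle of (F1) `CharHypothesis` / (F1♯) `GeomDirHypothesis`) and the binders keyed on it are SECTION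
VARIABLES: every theorem below takes them as its FIRST explicit arguments, in the order `F`, `h314f`[, `hPb`, `h314`]. -/

variable {T : BlowupTower.{u}} {N : ℕ}
  (F : ∀ (X : Scheme.{u}) [IsLocallyNoetherian X], X → Prop)
  (h314f : ∀ (X X' : Scheme.{u}) [IsLocallyNoetherian X] (π : X' ⟶ X) (D : X.IdealSheafData),
    Scheme.IsExcellent X → IdealSheafData.IsPermissible D → IsBlowup π D →
      ∀ N : ℕ, topologicalKrullDim X ≤ (N : WithBot ℕ∞) →
        ∀ x : X, x ∈ D.support → F X x →
          (Scheme.dirDim X x : WithBot ℕ∞) ≤ ringKrullDim (X.presheaf.stalk x ⧸ stalkIdeal D x) + 1 →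
            {x' : X' | π.base x' = x ∧ Scheme.hsFun X' N x' = Scheme.hsFun X N x}.Subsingleton)

section Dominant

include h314f

/-- **Points of `N_{j+1}(x)` over non-generic points of `C_j` are CLOSED**: such a point is the whole near fibre over a closed
point. [cite: CossartJannsenSaito2020, Thm. 3.14, p. 94] -/
theorem isClosed_singleton_of_mem_nearLocus_succ (hT36 : CossartJannsenSaito2020_thm_3_6.{u})
    (h3104 : CossartJannsenSaito2020_thm_3_10_4.{u}) (hkey : KeySetting T N)
    (hperm : ∀ j, IdealSheafData.IsPermissible (T.centreIdeal j))
    (hcl : ∀ (j : ℕ) (μ : ℕ → ℕ), IsClosed (Scheme.hsStratumGE (T.X j) N μ))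
    {x : T.X 0} (hx : IsClosed ({x} : Set (T.X 0)))
    (hF : ∀ i, ∀ y ∈ T.nearLocus N x i, @F (T.X i) (T.ln i) y) (hē : T.geomDirDimAt 0 x ≤ 2) {j : ℕ}
    (hNC : T.nearLocus N x j ⊆ T.C j) (hCN : T.C j ⊆ T.nearLocus N x j)
    (hirr : IsIrreducible (T.C j)) (hnt : (T.C j).Nontrivial)
    (hpts : ∀ y ∈ T.C j, ¬ IsGenericPoint y (T.C j) → IsClosed ({y} : Set (T.X j)))
    {z : T.X (j + 1)} (hz : z ∈ T.nearLocus N x (j + 1)) (hgen : ¬ IsGenericPoint ((T.π j).base z) (T.C j)) :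
    IsClosed ({z} : Set (T.X (j + 1))) := by
  have hz' := (BlowupTowerNear.mem_nearLocus_succ_iff T hkey hperm x j z).mp hz
  have hyC : (T.π j).base z ∈ T.C j := hNC hz'.1
  have hycl : IsClosed ({(T.π j).base z} : Set (T.X j)) := hpts _ hyC hgen
  have heq : ({z} : Set (T.X (j + 1))) = T.nearLocus N x (j + 1) ∩ (T.π j).base ⁻¹' {(T.π j).base z} := by
    ext w
    simp only [Set.mem_singleton_iff, Set.mem_inter_iff, Set.mem_preimage]
    constructor
    · rintro rfl; exact ⟨hz, rfl⟩
    · rintro ⟨hw, hwz⟩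
      exact nearLocus_succ_injOn F h314f hT36 h3104 hkey hperm hF hē hNC hCN hirr hnt hpts hw hz hwz
  rw [heq]
  exact (BlowupTowerNear.isClosed_nearLocus T hkey hperm hcl hx (j + 1)).inter (hycl.preimage (T.π j).continuous)

/-- **DOMINANT CASE: `π_{j+1}` is a BIJECTION `N_{j+1}(x) → C_j`.** [cite: CossartJannsenSaito2020, p. 104] -/
theorem bijOn_nearLocus_succ_of_dominant (hT36 : CossartJannsenSaito2020_thm_3_6.{u})
    (h3104 : CossartJannsenSaito2020_thm_3_10_4.{u}) (hkey : KeySetting T N)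
    (hperm : ∀ j, IdealSheafData.IsPermissible (T.centreIdeal j))
    (hcl : ∀ (j : ℕ) (μ : ℕ → ℕ), IsClosed (Scheme.hsStratumGE (T.X j) N μ))
    {x : T.X 0} (hx : IsClosed ({x} : Set (T.X 0)))
    (hF : ∀ i, ∀ y ∈ T.nearLocus N x i, @F (T.X i) (T.ln i) y) (hē : T.geomDirDimAt 0 x ≤ 2) {j : ℕ}
    (hNC : T.nearLocus N x j ⊆ T.C j) (hCN : T.C j ⊆ T.nearLocus N x j)
    (hirr : IsIrreducible (T.C j)) (hnt : (T.C j).Nontrivial)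
    (hpts : ∀ y ∈ T.C j, ¬ IsGenericPoint y (T.C j) → IsClosed ({y} : Set (T.X j)))
    {η : T.X j} (hη : IsGenericPoint η (T.C j)) (hdom : η ∈ (T.π j).base '' T.nearLocus N x (j + 1)) :
    Set.BijOn (T.π j).base (T.nearLocus N x (j + 1)) (T.C j) := by
  refine ⟨fun z hz => hNC ((BlowupTowerNear.mem_nearLocus_succ_iff T hkey hperm x j z).mp hz).1, nearLocus_succ_injOn F h314f hT36 h3104 hkey hperm hF hē hNC hCN hirr hnt hpts, ?_⟩
  intro y hy
  rw [← BlowupTowerNear.image_nearLocus_succ_eq_of_dominant T hkey hperm hcl hx (hNC) hη hdom] at hy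
  exact hy

/-- **DOMINANT CASE: `N_{j+1}(x)` is IRREDUCIBLE.** [cite: CossartJannsenSaito2020, p. 94, p. 104] -/
theorem isIrreducible_nearLocus_succ_of_dominant (hT36 : CossartJannsenSaito2020_thm_3_6.{u})
    (h3104 : CossartJannsenSaito2020_thm_3_10_4.{u}) (hkey : KeySetting T N)
    (hperm : ∀ j, IdealSheafData.IsPermissible (T.centreIdeal j))
    (hcl : ∀ (j : ℕ) (μ : ℕ → ℕ), IsClosed (Scheme.hsStratumGE (T.X j) N μ))
    {x : T.X 0} (hx : IsClosed ({x} : Set (T.X 0)))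
    (hF : ∀ i, ∀ y ∈ T.nearLocus N x i, @F (T.X i) (T.ln i) y) (hē : T.geomDirDimAt 0 x ≤ 2) {j : ℕ}
    (hNC : T.nearLocus N x j ⊆ T.C j) (hCN : T.C j ⊆ T.nearLocus N x j)
    (hirr : IsIrreducible (T.C j)) (hnt : (T.C j).Nontrivial)
    (hpts : ∀ y ∈ T.C j, ¬ IsGenericPoint y (T.C j) → IsClosed ({y} : Set (T.X j)))
    {η : T.X j} (hη : IsGenericPoint η (T.C j)) (hdom : η ∈ (T.π j).base '' T.nearLocus N x (j + 1)) :
    IsIrreducible (T.nearLocus N x (j + 1)) := by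
  haveI : ∀ j, IsLocallyNoetherian (T.X j) := T.ln
  haveI : IsProper (T.π j) := (T.isBlowup j).isProper
  exact isIrreducible_of_bijOn_of_isClosedMap (T.π j).isClosedMap (BlowupTowerNear.isClosed_nearLocus T hkey hperm hcl hx (j + 1))
    (bijOn_nearLocus_succ_of_dominant F h314f hT36 h3104 hkey hperm hcl hx hF hē hNC hCN hirr hnt hpts hη hdom) hirr

/-- **DOMINANT CASE: `N_{j+1}(x)` is NOT a single point.** [cite: CossartJannsenSaito2020, p. 104] -/
theorem nontrivial_nearLocus_succ_of_dominant (hT36 : CossartJannsenSaito2020_thm_3_6.{u})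
    (h3104 : CossartJannsenSaito2020_thm_3_10_4.{u}) (hkey : KeySetting T N)
    (hperm : ∀ j, IdealSheafData.IsPermissible (T.centreIdeal j))
    (hcl : ∀ (j : ℕ) (μ : ℕ → ℕ), IsClosed (Scheme.hsStratumGE (T.X j) N μ))
    {x : T.X 0} (hx : IsClosed ({x} : Set (T.X 0)))
    (hF : ∀ i, ∀ y ∈ T.nearLocus N x i, @F (T.X i) (T.ln i) y) (hē : T.geomDirDimAt 0 x ≤ 2) {j : ℕ}
    (hNC : T.nearLocus N x j ⊆ T.C j) (hCN : T.C j ⊆ T.nearLocus N x j)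
    (hirr : IsIrreducible (T.C j)) (hnt : (T.C j).Nontrivial)
    (hpts : ∀ y ∈ T.C j, ¬ IsGenericPoint y (T.C j) → IsClosed ({y} : Set (T.X j)))
    {η : T.X j} (hη : IsGenericPoint η (T.C j)) (hdom : η ∈ (T.π j).base '' T.nearLocus N x (j + 1)) :
    (T.nearLocus N x (j + 1)).Nontrivial := by
  have hbij := bijOn_nearLocus_succ_of_dominant F h314f hT36 h3104 hkey hperm hcl hx hF hē hNC hCN hirr hnt hpts hη hdom
  obtain ⟨y₁, hy₁, y₂, hy₂, hne⟩ := hnt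
  obtain ⟨z₁, hz₁, rfl⟩ := hbij.surjOn hy₁
  obtain ⟨z₂, hz₂, rfl⟩ := hbij.surjOn hy₂
  exact ⟨z₁, hz₁, z₂, hz₂, fun h => hne (h ▸ rfl)⟩

/-- **DOMINANT CASE: the generic point of `N_{j+1}(x)` is THE point over `η_j`** — a point of `N_{j+1}(x)` is generic iff its image is
the generic point of `C_j`. [cite: CossartJannsenSaito2020, p. 104] -/
theorem isGenericPoint_iff_of_dominant (hT36 : CossartJannsenSaito2020_thm_3_6.{u})
    (h3104 : CossartJannsenSaito2020_thm_3_10_4.{u}) (hkey : KeySetting T N)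
    (hperm : ∀ j, IdealSheafData.IsPermissible (T.centreIdeal j))
    (hcl : ∀ (j : ℕ) (μ : ℕ → ℕ), IsClosed (Scheme.hsStratumGE (T.X j) N μ))
    {x : T.X 0} (hx : IsClosed ({x} : Set (T.X 0)))
    (hF : ∀ i, ∀ y ∈ T.nearLocus N x i, @F (T.X i) (T.ln i) y) (hē : T.geomDirDimAt 0 x ≤ 2) {j : ℕ}
    (hNC : T.nearLocus N x j ⊆ T.C j) (hCN : T.C j ⊆ T.nearLocus N x j)
    (hirr : IsIrreducible (T.C j)) (hnt : (T.C j).Nontrivial)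
    (hpts : ∀ y ∈ T.C j, ¬ IsGenericPoint y (T.C j) → IsClosed ({y} : Set (T.X j)))
    {η : T.X j} (hη : IsGenericPoint η (T.C j)) (hdom : η ∈ (T.π j).base '' T.nearLocus N x (j + 1))
    {z : T.X (j + 1)} (hz : z ∈ T.nearLocus N x (j + 1)) :
    IsGenericPoint z (T.nearLocus N x (j + 1)) ↔ IsGenericPoint ((T.π j).base z) (T.C j) := by
  have himg := BlowupTowerNear.image_nearLocus_succ_eq_of_dominant T hkey hperm hcl hx (hNC) hη hdom
  have key : ∀ w : T.X (j + 1), IsGenericPoint w (T.nearLocus N x (j + 1)) → IsGenericPoint ((T.π j).base w) (T.C j) := by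
    intro w hw
    have h := hw.image (T.π j).continuous
    rwa [himg, (T.isClosed_C j).closure_eq] at h
  refine ⟨key z, fun hgz => ?_⟩
  have hirr' := isIrreducible_nearLocus_succ_of_dominant F h314f hT36 h3104 hkey hperm hcl hx hF hē hNC hCN hirr hnt hpts hη hdom
  have hζ : IsGenericPoint hirr'.genericPoint (T.nearLocus N x (j + 1)) :=
    hirr'.isGenericPoint_genericPoint (BlowupTowerNear.isClosed_nearLocus T hkey hperm hcl hx (j + 1))
  have heq : z = hirr'.genericPoint :=
    nearLocus_succ_injOn F h314f hT36 h3104 hkey hperm hF hē hNC hCN hirr hnt hpts hz hζ.mem (hgz.eq (key _ hζ))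
  rw [heq]; exact hζ

/-- **DOMINANT CASE: the non-generic points of `N_{j+1}(x)` are CLOSED** — so `(irreducible, nontrivial, non-generic points closed)`
REPRODUCES from `C_j` to `N_{j+1}(x)`, and the analysis runs again at stage `j + 1` once `C_{j+1} = N_{j+1}(x)`.
[cite: CossartJannsenSaito2020, p. 104] -/
theorem isClosed_singleton_of_mem_nearLocus_succ_of_dominant (hT36 : CossartJannsenSaito2020_thm_3_6.{u})
    (h3104 : CossartJannsenSaito2020_thm_3_10_4.{u}) (hkey : KeySetting T N)
    (hperm : ∀ j, IdealSheafData.IsPermissible (T.centreIdeal j))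
    (hcl : ∀ (j : ℕ) (μ : ℕ → ℕ), IsClosed (Scheme.hsStratumGE (T.X j) N μ))
    {x : T.X 0} (hx : IsClosed ({x} : Set (T.X 0)))
    (hF : ∀ i, ∀ y ∈ T.nearLocus N x i, @F (T.X i) (T.ln i) y) (hē : T.geomDirDimAt 0 x ≤ 2) {j : ℕ}
    (hNC : T.nearLocus N x j ⊆ T.C j) (hCN : T.C j ⊆ T.nearLocus N x j)
    (hirr : IsIrreducible (T.C j)) (hnt : (T.C j).Nontrivial)
    (hpts : ∀ y ∈ T.C j, ¬ IsGenericPoint y (T.C j) → IsClosed ({y} : Set (T.X j)))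
    {η : T.X j} (hη : IsGenericPoint η (T.C j)) (hdom : η ∈ (T.π j).base '' T.nearLocus N x (j + 1)) :
    ∀ z ∈ T.nearLocus N x (j + 1), ¬ IsGenericPoint z (T.nearLocus N x (j + 1)) → IsClosed ({z} : Set (T.X (j + 1))) :=
  fun _ hz hgz => isClosed_singleton_of_mem_nearLocus_succ F h314f hT36 h3104 hkey hperm hcl hx hF hē hNC hCN hirr hnt hpts hz
    (fun h => hgz ((isGenericPoint_iff_of_dominant F h314f hT36 h3104 hkey hperm hcl hx hF hē hNC hCN hirr hnt hpts hη hdom hz).mpr h))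

end Dominant

/-! ## The residue field at the generic point, and the isomorphism -/

section Iso

variable
  (hPb : ∀ (X X' : Scheme.{u}) [IsLocallyNoetherian X] [IsLocallyNoetherian X'] (π : X' ⟶ X) (D : X.IdealSheafData),
    Scheme.IsExcellent X → IdealSheafData.IsPermissible D → IsBlowup π D →
      ∀ N : ℕ, topologicalKrullDim ↥X ≤ (N : WithBot ℕ∞) →
        ∀ x' : X', π.base x' ∈ D.support → stalkIdeal D (π.base x') = maximalIdeal _ →
          F X (π.base x') → Scheme.dirDim X (π.base x') = 1 →
            Scheme.hsFun X' N x' = Scheme.hsFun X N (π.base x') → IsIso (π.residueFieldMap x'))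
  (h314 : ∀ (X X' : Scheme.{u}) [IsLocallyNoetherian X] [IsLocallyNoetherian X'] (π : X' ⟶ X) (D : X.IdealSheafData),
    Scheme.IsExcellent X → IdealSheafData.IsPermissible D → IsBlowup π D →
      ∀ N : ℕ, topologicalKrullDim X ≤ (N : WithBot ℕ∞) →
        ∀ x' : X', π.base x' ∈ D.support → F X (π.base x') →
          Scheme.hsFun X' N x' = Scheme.hsFun X N (π.base x') →
            ringKrullDim (X.presheaf.stalk (π.base x') ⧸ stalkIdeal D (π.base x')) <
              (Scheme.dirDim X (π.base x') : WithBot ℕ∞))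

include hPb h314

/-- **`κ(η_j) = κ(η_{j+1})`**: the point of `N_{j+1}(x)` over the generic point `η_j` of `C_j` has trivial residue extension — at
`η_j` one has `e = 1` exactly (`≤ 1` by (6.24), `≥ 1` by CJS Thm. 3.14 since a near point exists), the centre is the point `η_j`
locally (`𝓘_{C_j,η_j} = 𝔪_{η_j}`), and (F1) holds; the BINDER `hPb` is the residual-rationality half of CJS Thm. 3.14 for point centres
at `e = 1` (res-L1-s42-pv-1's P-b char door). [cite: CossartJannsenSaito2020, Thm. 3.14, (6.24), p. 104] -/
theorem isIso_residueFieldMap_of_mem_nearLocus_succ (hT36 : CossartJannsenSaito2020_thm_3_6.{u})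
    (h3104 : CossartJannsenSaito2020_thm_3_10_4.{u}) (hkey : KeySetting T N)
    (hperm : ∀ j, IdealSheafData.IsPermissible (T.centreIdeal j))
    {x : T.X 0} (hF : ∀ i, ∀ y ∈ T.nearLocus N x i, @F (T.X i) (T.ln i) y) (hē : T.geomDirDimAt 0 x ≤ 2) {j : ℕ}
    (hCN : T.C j ⊆ T.nearLocus N x j)
    (hirr : IsIrreducible (T.C j)) (hnt : (T.C j).Nontrivial)
    (hpts : ∀ y ∈ T.C j, ¬ IsGenericPoint y (T.C j) → IsClosed ({y} : Set (T.X j)))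
    {z : T.X (j + 1)} (hz : z ∈ T.nearLocus N x (j + 1)) (hgen : IsGenericPoint ((T.π j).base z) (T.C j)) :
    IsIso ((T.π j).residueFieldMap z) := by
  haveI : ∀ j, IsLocallyNoetherian (T.X j) := T.ln
  have hz' := (BlowupTowerNear.mem_nearLocus_succ_iff T hkey hperm x j z).mp hz
  set y := (T.π j).base z with hydef
  have hyC : y ∈ T.C j := hgen.mem
  have hsupp : ((T.centreIdeal j).support : Set (T.X j)) = T.C j := by
    rw [BlowupTower.centreIdeal, Scheme.IdealSheafData.coe_support_vanishingIdeal]; rfl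
  have hysupp : y ∈ (T.centreIdeal j).support := by rw [← SetLike.mem_coe, hsupp]; exact hyC
  have hchary : F (T.X j) y := hF j y (hCN hyC)
  have hmax : stalkIdeal (T.centreIdeal j) y = maximalIdeal _ :=
    stalkIdeal_vanishingIdeal_eq_maximalIdeal_of_closure_eq (Y := ⟨T.C j, T.isClosed_C j⟩) hgen.def.symm
  -- `e_y = 1`
  have hle : T.dirDimAt j y + 1 ≤ 2 :=
    (dirDim_generic_succ_le hT36 h3104 hkey hperm hCN hirr hnt hpts hgen).trans hē
  have hlt := h314 (T.X j) (T.X (j + 1)) (T.π j) (T.centreIdeal j) (BlowupTowerNear.isExcellent T hkey j) (hperm j) (T.isBlowup j) N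
    (BlowupTowerNear.topologicalKrullDim_le T hkey j) z hysupp hchary hz'.2
  have hnt' : Nontrivial ((T.X j).presheaf.stalk y ⧸ stalkIdeal (T.centreIdeal j) y) :=
    Ideal.Quotient.nontrivial_iff.mpr fun htop =>
      (maximalIdeal.isMaximal _).ne_top (top_le_iff.mp (htop ▸ (mem_support_iff_stalkIdeal_le _ y).mp hysupp))
  have h0 : (0 : WithBot ℕ∞) ≤ ringKrullDim ((T.X j).presheaf.stalk y ⧸ stalkIdeal (T.centreIdeal j) y) :=
    ringKrullDim_nonneg_of_nontrivial
  have hpos : (0 : WithBot ℕ∞) < (Scheme.dirDim (T.X j) y : WithBot ℕ∞) := h0.trans_lt hlt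
  have hpos' : 0 < Scheme.dirDim (T.X j) y := by exact_mod_cast hpos
  have he1 : Scheme.dirDim (T.X j) y = 1 := by
    rw [← BlowupTower.dirDimAt_eq] at hpos' ⊢; omega
  exact hPb (T.X j) (T.X (j + 1)) (T.π j) (T.centreIdeal j) (BlowupTowerNear.isExcellent T hkey j) (hperm j) (T.isBlowup j) N
    (BlowupTowerNear.topologicalKrullDim_le T hkey j) z hysupp hmax hchary he1 hz'.2

include h314f

/-- **(R3)+(R2), DOMINANT CASE: `π_{j+1}` INDUCES AN ISOMORPHISM `N_{j+1}(x) ⥲ C_j`** of reduced closed subschemes (CJS Def. 6.38 (iv)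
/ p. 104 «`π_q` induces an isomorphism `C_q ≅ C_{q−1}`»): a proper bijection, birational (`κ(η_{j+1}) = κ(η_j)`), onto the REGULAR
(hence normal) curve `C_j`. [cite: CossartJannsenSaito2020, Def. 6.38 (iv), p. 104] -/
theorem inducesIsoOn_nearLocus_succ_of_dominant (hT36 : CossartJannsenSaito2020_thm_3_6.{u})
    (h3104 : CossartJannsenSaito2020_thm_3_10_4.{u}) (hkey : KeySetting T N)
    (hperm : ∀ j, IdealSheafData.IsPermissible (T.centreIdeal j))
    (hcl : ∀ (j : ℕ) (μ : ℕ → ℕ), IsClosed (Scheme.hsStratumGE (T.X j) N μ))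
    {x : T.X 0} (hx : IsClosed ({x} : Set (T.X 0)))
    (hF : ∀ i, ∀ y ∈ T.nearLocus N x i, @F (T.X i) (T.ln i) y) (hē : T.geomDirDimAt 0 x ≤ 2) {j : ℕ}
    (hNC : T.nearLocus N x j ⊆ T.C j) (hCN : T.C j ⊆ T.nearLocus N x j)
    (hirr : IsIrreducible (T.C j)) (hnt : (T.C j).Nontrivial)
    (hpts : ∀ y ∈ T.C j, ¬ IsGenericPoint y (T.C j) → IsClosed ({y} : Set (T.X j)))
    {η : T.X j} (hη : IsGenericPoint η (T.C j)) (hdom : η ∈ (T.π j).base '' T.nearLocus N x (j + 1))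
    (hN : IsClosed (T.nearLocus N x (j + 1))) :
    InducesIsoOn (T.π j) (T.nearLocus N x (j + 1)) hN (T.C j) (T.isClosed_C j) := by
  haveI : ∀ j, IsLocallyNoetherian (T.X j) := T.ln
  haveI : IsProper (T.π j) := (T.isBlowup j).isProper
  have hreg : Scheme.IsRegular (T.centreIdeal j).subscheme := CampaignW42.isRegular_subscheme_of_isPermissible (hperm j)
  refine inducesIsoOn_of_bijOn_of_isIso_residueFieldMap_generic (T.π j) hN (T.isClosed_C j)
    (isIrreducible_nearLocus_succ_of_dominant F h314f hT36 h3104 hkey hperm hcl hx hF hē hNC hCN hirr hnt hpts hη hdom) hirr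
    (bijOn_nearLocus_succ_of_dominant F h314f hT36 h3104 hkey hperm hcl hx hF hē hNC hCN hirr hnt hpts hη hdom)
    (fun z hz hgz => isIso_residueFieldMap_of_mem_nearLocus_succ F hPb h314 hT36 h3104 hkey hperm hF hē hCN
      hirr hnt hpts hz ((isGenericPoint_iff_of_dominant F h314f hT36 h3104 hkey hperm hcl hx hF hē hNC hCN hirr hnt hpts hη hdom
        hz).mp hgz))
    (fun w => isIntegrallyClosed_stalk_of_isRegular hreg w)

/-- **(G2), DOMINANT CASE: `N_{j+1}(x)` with its reduced structure is REGULAR** (isomorphic to the permissible, hence regular,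
`C_j`). [cite: CossartJannsenSaito2020, Def. 6.38 (iv), Def. 3.1, p. 94] -/
theorem isRegular_nearLocus_succ_of_dominant (hT36 : CossartJannsenSaito2020_thm_3_6.{u})
    (h3104 : CossartJannsenSaito2020_thm_3_10_4.{u}) (hkey : KeySetting T N)
    (hperm : ∀ j, IdealSheafData.IsPermissible (T.centreIdeal j))
    (hcl : ∀ (j : ℕ) (μ : ℕ → ℕ), IsClosed (Scheme.hsStratumGE (T.X j) N μ))
    {x : T.X 0} (hx : IsClosed ({x} : Set (T.X 0)))
    (hF : ∀ i, ∀ y ∈ T.nearLocus N x i, @F (T.X i) (T.ln i) y) (hē : T.geomDirDimAt 0 x ≤ 2) {j : ℕ}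
    (hNC : T.nearLocus N x j ⊆ T.C j) (hCN : T.C j ⊆ T.nearLocus N x j)
    (hirr : IsIrreducible (T.C j)) (hnt : (T.C j).Nontrivial)
    (hpts : ∀ y ∈ T.C j, ¬ IsGenericPoint y (T.C j) → IsClosed ({y} : Set (T.X j)))
    {η : T.X j} (hη : IsGenericPoint η (T.C j)) (hdom : η ∈ (T.π j).base '' T.nearLocus N x (j + 1))
    (hN : IsClosed (T.nearLocus N x (j + 1))) :
    Scheme.IsRegular (vanishingIdeal (⟨T.nearLocus N x (j + 1), hN⟩ : Closeds (T.X (j + 1)))).subscheme := by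
  haveI : ∀ j, IsLocallyNoetherian (T.X j) := T.ln
  obtain ⟨e, -⟩ := inducesIsoOn_nearLocus_succ_of_dominant F h314f hPb h314 hT36 h3104 hkey hperm hcl hx hF hē hNC hCN hirr hnt
    hpts hη hdom hN
  exact Scheme.IsRegular.of_iso e.inv (CampaignW42.isRegular_subscheme_of_isPermissible (hperm j))

end Iso

end BlowupTowerNearW

end Summit.ResolutionOfSingularities.ResolutionOfSingularities.Theorems.SigmaMaxModificationsCorridor3.Helpers

end
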